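/-
Copyright (c) 2026. All rights reserved.
Released under Apache 2.0 license as described in the file LICENSE.
Authors: abc-iut cell, seat abc-iut-L4-t10 (gen 4; block W2-B4, Galois-category column of the model of
[AbsTopIII] Cor 4.5: the geometric fundamental groups of ALL hyperbolic curves over `ℂ`).
-/
import Literature.AnabelianGeometry.AbsoluteAnabelian.AbsTopIII.AutHolLogFrobeniusCor45FullModelProofs
import Literature.AnabelianGeometry.AbsoluteAnabelian.FiniteGSetsIdRigid
import Literature.GroupTheory.FreeGroupProfiniteCompletionSlim
import HarnessLib

/-!
# [AbsTopIII] Cor 4.5 (i)–(v) AS TYPED, OUTRIGHT, at the Galois-category instance `EA = B(Π̂)` for `Π̂`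
# the profinite completion of the topological fundamental group of ANY hyperbolic curve over `ℂ`

S. Mochizuki, *Topics in Absolute Anabelian Geometry III*, Cor 4.5 pp.107–109, Prop 4.2 (i) p.105 and
its proof p.106 l.11–19, Lemma 4.3 p.106 («the étale fundamental group of [a hyperbolic orbicurve
over a CAF] is slim») — kurims manuscript, lit key `paper:url-5493eb38cbb7`, read on the page; bib
key `MochizukiAbsTopIII2015`.  PROOF-ONLY file (no definition).

State of the tree before this file.  Seat abc-iut-L4-t10 (gen 3) typed the Galois-category instance
of the Cor 2.7 (e) interface, `AutHolFieldFunctor.ofGaloisCategory Π` (`EA := B(Π)`, the finite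
continuous `Π`-sets = the finite étale coverings of a fixed core with arithmetic fundamental group
`Π`; `𝒜 = ℂ`), proved print's route «id-rigidity of `EA` ⟸ slimness (Lemma 4.3)» there
(`AutHolFieldFunctor.isIdRigid_EA_ofGaloisCategory`, `AbsTopIII.cor_4_5_arch_ofGaloisCategory
(hG : IsSlimGroup Π) (X₀)`), and discharged it at ONE genuine group, `Π = G_{ℚ_p}`
(`cor_4_5_arch_absoluteGaloisGroup_padic`).  Since then the cell has proved slimness of the
profinite completions of the GEOMETRIC fundamental groups of hyperbolic curves over `ℂ`:
free groups `F_n`, `n ≥ 2` (`Literature.GroupTheory.isSlimGroup_profiniteCompletion_freeGroup`,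
abc-iut-w5-d016: `π₁` of the plane punctured at `n ≥ 2` points), punctured surface groups `Γ_{g,r}`
of hyperbolic type (`isSlimGroup_profiniteCompletion_puncturedSurfaceGroup`, F-0037 at the
completion, [AbsAnab] Lemma 1.3.1) — including the closed surface groups `Γ_{g,0}`, `g ≥ 2`.

This file (every theorem a short application BY NAME, the object `X₀` being the one-point
`Π̂`-set `Π̂/Π̂`, "the core itself"):

* `AbsTopIII.cor_4_5_arch_ofGaloisCategory_top` — bookkeeping: for EVERY slim profinite `Π` the binder
  `X₀ : B(Π)` of gen 3's theorem is discharged by `Π/Π`.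
* `AbsTopIII.cor_4_5_arch_profiniteCompletion_freeGroup` — **Cor 4.5 (i)–(v) OUTRIGHT at
  `EA = B(F̂_n)`, `n ≥ 2`** (`F̂₂ = π̂₁(ℙ¹ ∖ {0,1,∞})`: the étale site of the thrice-punctured sphere).
* `AbsTopIII.cor_4_5_arch_profiniteCompletion_puncturedSurfaceGroup` — **Cor 4.5 (i)–(v) OUTRIGHT at
  `EA = B(Γ̂_{g,r})` for EVERY hyperbolic type `2g − 2 + r > 0`** — i.e. for the geometric étale
  fundamental group of every hyperbolic curve over `ℂ` (affine AND proper); the closed case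
  `cor_4_5_arch_profiniteCompletion_surfaceGroup` (`g ≥ 2`).
* `…_full_…_iff` companions — at each of these, `Cor_4_5_full` (the five items and the three
  compatibility sentences of (iii)/(v)) holds IFF the telecore half of the (iii) clause
  (`LogObsCompatTelecoreStmt`, the cell's one open input at the archimedean models; seat
  abc-iut-L4-t10 gen 4's `cor_4_5_full_arch_ofGaloisCategory_iff`).

HONEST SCOPE: model-level; `B(Π̂_X)` is the Galois category of ONE core (print's `EA` ranges over
all elliptically admissible hyperbolic orbicurves with all finite étale morphisms — the geometric
`HolRS` column of abc-iut-L4-t14 / -t12 / gen 4's `ArchimedeanHolFieldFunctorGeometricTripodCovers`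
is the other reading); the identification `Π̂_X ≅ Γ̂_{g,r}` (classification of surfaces) is not
asserted here — the theorems are stated AT the completed presentation groups.  Node
`AbsTopIII:Cor4.5` is not a counting node.  Refereed pre-IUT anabelian geometry; nothing here bears
on [IUTchIII] Cor. 3.12 or takes a side; typed ≠ proved.
-/

noncomputable section

namespace Literature.AnabelianGeometry.AbsoluteAnabelian

open _root_.CategoryTheory
open Literature.AlgebraicGeometry.Frobenioids (IsSlimGroup BCat)
open Literature.IUT.HodgeTheaters (profiniteCompletion)
open Literature.GroupTheory.CombinatorialGroupTheory (PuncturedSurfaceGroup)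
open Literature.AnabelianGeometry.Anabelioids (Induction.quotObj)

namespace AbsTopIII

/-! ### The binder `X₀ : B(Π)` is always discharged by the one-point `Π`-set -/

/-- **Cor 4.5 (i)–(v) at `EA = B(Π)` for EVERY slim profinite group `Π`, with the object binder
discharged**: the one-point `Π`-set `Π/Π` ("the core itself") is an object of `B(Π)`, so gen 3's
`cor_4_5_arch_ofGaloisCategory` needs slimness only (print's Lemma 4.3 ⟹ Prop 4.2 (i) route).
[cite: MochizukiAbsTopIII2015, Corollary 4.5 pp.107–109] -/
theorem cor_4_5_arch_ofGaloisCategory_top (G : Type) [Group G] [TopologicalSpace G]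
    [IsTopologicalGroup G] [CompactSpace G] [T2Space G] [TotallyDisconnectedSpace G]
    (hG : IsSlimGroup G) :
    Cor_4_5 (archLogFrobeniusData (AutHolFieldFunctor.ofGaloisCategory G))
      (archTelecoreData (AutHolFieldFunctor.ofGaloisCategory G)) := by
  haveI : Subsingleton (G ⧸ (⊤ : Subgroup G)) := QuotientGroup.subsingleton_quotient_top
  haveI : Finite (G ⧸ (⊤ : Subgroup G)) := Finite.of_subsingleton
  exact cor_4_5_arch_ofGaloisCategory hG (Induction.quotObj (⊤ : Subgroup G) isOpen_univ)

/-- At `EA = B(Π)` for a slim profinite `Π`, `Cor_4_5_full` (all printed clauses) holds IFF the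
telecore half of the (iii) compatibility clause does (gen 4's `cor_4_5_full_arch_ofGaloisCategory_iff`
with the object binder discharged). [cite: MochizukiAbsTopIII2015, Corollary 4.5 pp.107–109] -/
theorem cor_4_5_full_arch_ofGaloisCategory_top_iff (G : Type) [Group G] [TopologicalSpace G]
    [IsTopologicalGroup G] [CompactSpace G] [T2Space G] [TotallyDisconnectedSpace G]
    (hG : IsSlimGroup G) :
    Cor_4_5_full (archLogFrobeniusData (AutHolFieldFunctor.ofGaloisCategory G))
        (archTelecoreData (AutHolFieldFunctor.ofGaloisCategory G)) ↔
      (archLogFrobeniusData (AutHolFieldFunctor.ofGaloisCategory G)).LogObsCompatTelecoreStmt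
        (archTelecoreData (AutHolFieldFunctor.ofGaloisCategory G)) :=
  cor_4_5_full_arch_iff_of_cor_4_5 _ (cor_4_5_arch_ofGaloisCategory_top G hG)

/-! ### The free profinite groups `F̂_n`, `n ≥ 2` (punctured spheres) -/

/-- **[AbsTopIII] Cor 4.5 (i)–(v) AS TYPED hold OUTRIGHT at the Galois-category instance
`EA = B(F̂_n)`, `n ≥ 2`** — `F̂_n` the profinite completion of the free group on `n` letters, the
geometric étale fundamental group of `ℙ¹_ℂ` minus `n + 1` points (`n = 2`: the thrice-punctured
sphere); slim by abc-iut-w5-d016's `isSlimGroup_profiniteCompletion_freeGroup` (Lemma 4.3 at this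
group). [cite: MochizukiAbsTopIII2015, Corollary 4.5 pp.107–109] -/
theorem cor_4_5_arch_profiniteCompletion_freeGroup {n : ℕ} (hn : 2 ≤ n) :
    Cor_4_5 (archLogFrobeniusData (AutHolFieldFunctor.ofGaloisCategory
        (profiniteCompletion (FreeGroup (Fin n)))))
      (archTelecoreData (AutHolFieldFunctor.ofGaloisCategory
        (profiniteCompletion (FreeGroup (Fin n))))) :=
  cor_4_5_arch_ofGaloisCategory_top _ (Literature.GroupTheory.isSlimGroup_profiniteCompletion_freeGroup hn)

/-- At `EA = B(F̂_n)`, `n ≥ 2`: `Cor_4_5_full` iff the telecore half of (iii), ZERO other binders.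
[cite: MochizukiAbsTopIII2015, Corollary 4.5 pp.107–109] -/
theorem cor_4_5_full_arch_profiniteCompletion_freeGroup_iff {n : ℕ} (hn : 2 ≤ n) :
    Cor_4_5_full (archLogFrobeniusData (AutHolFieldFunctor.ofGaloisCategory
        (profiniteCompletion (FreeGroup (Fin n)))))
      (archTelecoreData (AutHolFieldFunctor.ofGaloisCategory
        (profiniteCompletion (FreeGroup (Fin n))))) ↔
      (archLogFrobeniusData (AutHolFieldFunctor.ofGaloisCategory
        (profiniteCompletion (FreeGroup (Fin n))))).LogObsCompatTelecoreStmt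
        (archTelecoreData (AutHolFieldFunctor.ofGaloisCategory
          (profiniteCompletion (FreeGroup (Fin n))))) :=
  cor_4_5_full_arch_ofGaloisCategory_top_iff _
    (Literature.GroupTheory.isSlimGroup_profiniteCompletion_freeGroup hn)

/-! ### The surface groups `Γ̂_{g,r}` of hyperbolic type (every hyperbolic curve over `ℂ`) -/

/-- **[AbsTopIII] Cor 4.5 (i)–(v) AS TYPED hold OUTRIGHT at the Galois-category instance
`EA = B(Γ̂_{g,r})` for EVERY hyperbolic type `(g, r)`, `2g − 2 + r > 0`** — `Γ̂_{g,r}` the profinite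
completion of the surface group `⟨a₁, b₁, …, a_g, b_g, c₁, …, c_r ∣ [a₁,b₁]⋯[a_g,b_g]·c₁⋯c_r⟩`, the
geometric étale fundamental group of a hyperbolic curve of type `(g, r)` over `ℂ`; slim by
[AbsAnab] Lemma 1.3.1 / F-0037 at the completion (`isSlimGroup_profiniteCompletion_puncturedSurfaceGroup`)
— print's Lemma 4.3 for this core. [cite: MochizukiAbsTopIII2015, Corollary 4.5 pp.107–109] -/
theorem cor_4_5_arch_profiniteCompletion_puncturedSurfaceGroup {g r : ℕ}
    (hgr : PuncturedSurfaceGroup.IsHyperbolicType g r) :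
    Cor_4_5 (archLogFrobeniusData (AutHolFieldFunctor.ofGaloisCategory
        (profiniteCompletion (PuncturedSurfaceGroup g r))))
      (archTelecoreData (AutHolFieldFunctor.ofGaloisCategory
        (profiniteCompletion (PuncturedSurfaceGroup g r)))) :=
  cor_4_5_arch_ofGaloisCategory_top _ (isSlimGroup_profiniteCompletion_puncturedSurfaceGroup hgr)

/-- At `EA = B(Γ̂_{g,r})`, hyperbolic `(g, r)`: `Cor_4_5_full` iff the telecore half of (iii), ZERO
other binders. [cite: MochizukiAbsTopIII2015, Corollary 4.5 pp.107–109] -/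
theorem cor_4_5_full_arch_profiniteCompletion_puncturedSurfaceGroup_iff {g r : ℕ}
    (hgr : PuncturedSurfaceGroup.IsHyperbolicType g r) :
    Cor_4_5_full (archLogFrobeniusData (AutHolFieldFunctor.ofGaloisCategory
        (profiniteCompletion (PuncturedSurfaceGroup g r))))
      (archTelecoreData (AutHolFieldFunctor.ofGaloisCategory
        (profiniteCompletion (PuncturedSurfaceGroup g r)))) ↔
      (archLogFrobeniusData (AutHolFieldFunctor.ofGaloisCategory
        (profiniteCompletion (PuncturedSurfaceGroup g r)))).LogObsCompatTelecoreStmt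
        (archTelecoreData (AutHolFieldFunctor.ofGaloisCategory
          (profiniteCompletion (PuncturedSurfaceGroup g r)))) :=
  cor_4_5_full_arch_ofGaloisCategory_top_iff _
    (isSlimGroup_profiniteCompletion_puncturedSurfaceGroup hgr)

/-- **The proper case**: Cor 4.5 (i)–(v) AS TYPED hold OUTRIGHT at `EA = B(Γ̂_g)` for the closed
surface group of genus `g ≥ 2` (type `(g, 0)` is hyperbolic). [cite: MochizukiAbsTopIII2015, Corollary 4.5 pp.107–109] -/
theorem cor_4_5_arch_profiniteCompletion_surfaceGroup {g : ℕ} (hg : 2 ≤ g) :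
    Cor_4_5 (archLogFrobeniusData (AutHolFieldFunctor.ofGaloisCategory
        (profiniteCompletion (PuncturedSurfaceGroup g 0))))
      (archTelecoreData (AutHolFieldFunctor.ofGaloisCategory
        (profiniteCompletion (PuncturedSurfaceGroup g 0)))) :=
  cor_4_5_arch_profiniteCompletion_puncturedSurfaceGroup
    (by unfold PuncturedSurfaceGroup.IsHyperbolicType; omega)

/-- **The once-punctured curves of genus `g ≥ 1`** (type `(g, 1)`; `g = 1`: the once-punctured
elliptic curve of inter-universal Teichmüller theory): Cor 4.5 (i)–(v) AS TYPED hold OUTRIGHT at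
`EA = B(Γ̂_{g,1})`. [cite: MochizukiAbsTopIII2015, Corollary 4.5 pp.107–109] -/
theorem cor_4_5_arch_profiniteCompletion_oncePuncturedSurfaceGroup {g : ℕ} (hg : 1 ≤ g) :
    Cor_4_5 (archLogFrobeniusData (AutHolFieldFunctor.ofGaloisCategory
        (profiniteCompletion (PuncturedSurfaceGroup g 1))))
      (archTelecoreData (AutHolFieldFunctor.ofGaloisCategory
        (profiniteCompletion (PuncturedSurfaceGroup g 1)))) :=
  cor_4_5_arch_profiniteCompletion_puncturedSurfaceGroup
    (by unfold PuncturedSurfaceGroup.IsHyperbolicType; omega)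

end AbsTopIII

end Literature.AnabelianGeometry.AbsoluteAnabelian
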